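import Literature.NumberTheory.GaloisRepresentations.DyadicMonomialLiftUnramified
import Literature.NumberTheory.GaloisRepresentations.TeichmullerLiftMonomial
import Literature.NumberTheory.GaloisRepresentations.ResidualRepTwist
import Literature.NumberTheory.GaloisRepresentations.FramedRepTwist
import Literature.NumberTheory.GaloisRepresentations.ProjectiveTypeSolvable
import HarnessLib

/-!
# Twisting by a finite-order character preserves the Langlands–Tunnell hypotheses; the global
# dyadic character with prescribed inertial restriction is residually trivial (proofs only)

Topic `Literature/NumberTheory/GaloisRepresentations`; namespace
`Literature.NumberTheory.GaloisRepresentations`.  THEOREMS ONLY (no definition, no named fact;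
D-0026).  Bookkeeping for the RAMIFIED case of the classical substitute for
[WilesOrdinary, Theorem 3] in Allen, Compos. Math. 150 (2014), Lemma 87 over `ℚ`: the weight-one
form `f₁` is replaced by the newform of the twist `ρ₁ ⊗ θ₀⁻¹`, where `θ₀` is a global finite-order
character agreeing on the inertia group at `2` with the character `χ₂` of the local shape
`ρ₁|_{Γ_{ℚ₂}} ≅ χ₁ ⊕ χ₂`.

* `FramedRep.isOpen_ker_twist`, `not_hasCommonEigenvector_twist`, `FramedGaloisRep.isOdd_twist`,
  `FramedRep.isSolvable_range_twist`: the four hypotheses of the tree's Langlands–Tunnell transport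
  (`exists_weightOne_newform_of_langlands_tunnell`) survive twisting by a continuous character with
  open kernel.
* `FramedRep.coe_conj_twist_of_diagonal`: the local shape of a twist.
* `FramedGaloisRep.toLocal_eq_one_of_isUnramifiedAt`: framed `→` direction of the tree's
  `GaloisRep.isUnramifiedAt_iff_toLocal_holds`.
* `PadicAlgCl.exists_residue_eq_one_of_pow_two_pow_eq_one`: a `2`-power root of unity of `ℚ̄₂`
  is residually trivial (`(ζ̄ - 1)^{2^r} = ζ̄^{2^r} - 1 = 0` in characteristic `2`).
* `adicCompletion_rat_exists_continuousMonoidHom_apply_absGaloisRestrict_eq`: the global character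
  `θ₀ : Γ_ℚ →ₜ* ℚ̄_pˣ` of `p`-power-times-`(p-1)` order agreeing with a given continuous finite-order
  `χ : Γ_{ℚ_v} → ℤ̄_p` on the inertia group (the tree's
  `adicCompletion_rat_exists_monoidHom_apply_absGaloisRestrict_eq_of_mem_absInertia`, local
  Kronecker–Weber in inertia form, made continuous).

## References

* P. B. Allen, Compos. Math. 150 (2014), Lemma 87 (arXiv:1301.1113v2, §5.1.1, p. 70). [Allen2014]
* J.-P. Serre, *Local Fields* (1979), Ch. XIV §7 Thm. 2. [SerreLocalFields1979]
* J.-P. Serre, *Abelian ℓ-adic representations* (1968), Ch. I §1.1. [SerreAbelianLadic1968]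
-/

noncomputable section

open scoped MatrixGroups Matrix NumberField

open IsDedekindDomain IsLocalRing Field Polynomial

namespace Literature.NumberTheory.GaloisRepresentations

/-! ### The Langlands–Tunnell hypotheses survive twisting -/

section Twist

variable {G : Type*} [Group G] [TopologicalSpace G]
  {F : Type*} [Field F] [TopologicalSpace F] [IsTopologicalRing F] {n : ℕ}

/-- The kernel of `ρ ⊗ χ` contains `ker ρ ∩ ker χ`, hence is open when both are. [folklore] -/
theorem FramedRep.isOpen_ker_twist [IsTopologicalGroup G] (ρ : FramedRep G F n) (χ : G →ₜ* Fˣ)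
    (hρ : IsOpen (((ρ : G →* GL (Fin n) F)).ker : Set G))
    (hχ : IsOpen (((χ : G →* Fˣ)).ker : Set G)) :
    IsOpen (((ρ.twist χ : G →* GL (Fin n) F)).ker : Set G) := by
  refine Subgroup.isOpen_mono (H₁ := (ρ : G →* GL (Fin n) F).ker ⊓ (χ : G →* Fˣ).ker) ?_ ?_
  · intro g hg
    rw [Subgroup.mem_inf, MonoidHom.mem_ker, MonoidHom.mem_ker] at hg
    rw [MonoidHom.mem_ker]
    change ρ.twist χ g = 1
    rw [FramedRep.twist_apply]
    change FramedRep.scalar F n (χ g) * ρ g = 1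
    have h2 : χ g = 1 := hg.2
    rw [h2, map_one, one_mul]
    exact hg.1
  · rw [Subgroup.coe_inf]
    exact hρ.inter hχ

/-- `ρ ⊗ χ` has a common eigenvector iff `ρ` has (`(ρ ⊗ χ)(g) v = χ(g) ρ(g) v`). [folklore] -/
theorem not_hasCommonEigenvector_twist (ρ : FramedRep G F 2) (χ : G →ₜ* Fˣ)
    (h : ¬ HasCommonEigenvector (ρ : G →* GL (Fin 2) F)) :
    ¬ HasCommonEigenvector (ρ.twist χ : G →* GL (Fin 2) F) := by
  rintro ⟨v, hv, hev⟩
  refine h ⟨v, hv, fun g ↦ ?_⟩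
  obtain ⟨a, ha⟩ := hev g
  change (((ρ.twist χ g : GL (Fin 2) F)) : Matrix (Fin 2) (Fin 2) F) *ᵥ v = a • v at ha
  rw [FramedRep.coe_twist_apply, Matrix.smul_mulVec] at ha
  have h1 := congrArg (fun x ↦ (((χ g)⁻¹ : Fˣ) : F) • x) ha
  simp only [smul_smul, ← Units.val_mul, inv_mul_cancel, Units.val_one, one_smul] at h1
  exact ⟨_, h1⟩

/-- `det (ρ ⊗ χ)(c) = χ(c)² det ρ(c) = det ρ(c)` at an involution `c`: twists of odd
two-dimensional representations are odd. [folklore] -/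
theorem FramedGaloisRep.isOdd_twist {K : Type*} [Field K] (ρ : FramedGaloisRep K F 2)
    (χ : absoluteGaloisGroup K →ₜ* Fˣ) (hρ : ρ.IsOdd) :
    FramedGaloisRep.IsOdd (FramedRep.twist ρ χ) := by
  intro φ c hc
  change Matrix.GeneralLinearGroup.det (FramedRep.twist ρ χ c) = -1
  rw [FramedRep.det_twist_apply, ← map_pow, hc.sq_eq_one, map_one, one_mul]
  exact hρ φ c hc

/-- The image of `ρ ⊗ χ` lies in the image of `(c, A) ↦ c · A` on `Fˣ × ρ(G)`, a quotient of a
solvable group when `ρ(G)` is solvable. [folklore] -/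
theorem FramedRep.isSolvable_range_twist (ρ : FramedRep G F n) (χ : G →ₜ* Fˣ)
    (h : IsSolvable (ρ : G →* GL (Fin n) F).range) :
    IsSolvable (ρ.twist χ : G →* GL (Fin n) F).range := by
  set S : Subgroup (GL (Fin n) F) := (ρ : G →* GL (Fin n) F).range with hS
  let Φ : Fˣ × S →* GL (Fin n) F :=
    MonoidHom.noncommCoprod ((FramedRep.scalar F n : Fˣ →ₜ* GL (Fin n) F) : Fˣ →* GL (Fin n) F)
      S.subtype (fun c A ↦ FramedRep.scalar_commute c (A : GL (Fin n) F))
  haveI : IsSolvable (Fˣ × S) := inferInstance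
  haveI : IsSolvable Φ.range := solvable_of_surjective (MonoidHom.rangeRestrict_surjective Φ)
  have hle : (ρ.twist χ : G →* GL (Fin n) F).range ≤ Φ.range := by
    rintro _ ⟨g, rfl⟩
    refine ⟨(χ g, ⟨ρ g, g, rfl⟩), ?_⟩
    rw [MonoidHom.noncommCoprod_apply]
    rfl
  exact solvable_of_solvable_injective (Subgroup.inclusion_injective hle)

/-- **The local shape of a twist**: if `P⁻¹ ρ(g) P = diag(a, b)` then
`P⁻¹ (ρ ⊗ χ)(g) P = diag(χ(g) a, χ(g) b)`. [folklore] -/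
theorem FramedRep.coe_conj_twist_of_diagonal {ρ : FramedRep G F 2} {P : GL (Fin 2) F} {g : G}
    {a b : F} (h : ((P⁻¹ * ρ g * P : GL (Fin 2) F) : Matrix (Fin 2) (Fin 2) F) = Matrix.diagonal ![a, b])
    (χ : G →ₜ* Fˣ) :
    ((P⁻¹ * ρ.twist χ g * P : GL (Fin 2) F) : Matrix (Fin 2) (Fin 2) F) =
      Matrix.diagonal ![(χ g : F) * a, (χ g : F) * b] := by
  have h1 : ((P⁻¹ * ρ.twist χ g * P : GL (Fin 2) F) : Matrix (Fin 2) (Fin 2) F) =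
      (χ g : F) • ((P⁻¹ * ρ g * P : GL (Fin 2) F) : Matrix (Fin 2) (Fin 2) F) := by
    simp only [Units.val_mul, FramedRep.coe_twist_apply, Matrix.mul_smul, Matrix.smul_mul]
  rw [h1, h, ← Matrix.diagonal_smul]
  congr 1
  funext i
  fin_cases i <;> simp

end Twist

section Conj

variable {F : Type*} [Field F] {n : ℕ}

/-- A conjugate of `1` is `1`: `P⁻¹ M P = 1 ⇒ M = 1`. [folklore] -/
theorem GeneralLinearGroup.eq_one_of_coe_conj_eq_one {P M : GL (Fin n) F}
    (h : ((P⁻¹ * M * P : GL (Fin n) F) : Matrix (Fin n) (Fin n) F) = 1) : M = 1 := by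
  have h1 : P⁻¹ * M * P = 1 := Units.ext (by rw [h, Units.val_one])
  calc M = P * (P⁻¹ * M * P) * P⁻¹ := by group
    _ = 1 := by rw [h1, mul_one, mul_inv_cancel]

end Conj

/-! ### Framed form of `isUnramifiedAt_iff_toLocal`, direction `→` -/

section Unramified

variable {K : Type*} [Field K] [NumberField K] {A : Type*} [CommRing A] [TopologicalSpace A]
  [IsTopologicalRing A] {n : ℕ}

/-- **`ρ` unramified at `v` ⟹ `ρ|_{Γ_{K_v}}` trivial on inertia** (framed form of the `→`
direction of the tree's `GaloisRep.isUnramifiedAt_iff_toLocal_holds`; Neukirch II (9.6)).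
[cite: NeukirchANT1999, Ch. II §9 Prop. (9.6)] -/
theorem FramedGaloisRep.toLocal_eq_one_of_isUnramifiedAt (v : HeightOneSpectrum (𝓞 K))
    (ρ : FramedGaloisRep K A n) (h : ρ.IsUnramifiedAt v)
    {σ : absoluteGaloisGroup (v.adicCompletion K)} (hσ : σ ∈ absInertia (v.adicCompletion K)) :
    ρ.toLocal v σ = 1 := by
  rw [← FramedGaloisRep.isUnramifiedAt_toGaloisRep_iff] at h
  have h1 := (GaloisRep.isUnramifiedAt_iff_toLocal_holds v ρ.toGaloisRep).1 h σ hσ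
  rw [GaloisRep.toLocal_apply] at h1
  change FramedRep.toRepresentation ρ (absGaloisRestrict K (v.adicCompletion K) σ) = 1 at h1
  rw [FramedGaloisRep.toLocal_apply]
  have h2 : Matrix.toLin' ((ρ (absGaloisRestrict K (v.adicCompletion K) σ) : GL (Fin n) A) :
      Matrix (Fin n) (Fin n) A) = Matrix.toLin' 1 := by
    rw [Matrix.toLin'_one]
    refine LinearMap.ext fun w ↦ ?_
    simpa using congr($h1 w)
  exact Units.ext (Matrix.toLin'.injective h2)

end Unramified

/-! ### `2`-power roots of unity of `ℚ̄₂` are residually trivial -/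

section Dyadic

/-- **A `2`-power root of unity `ζ ∈ ℚ̄₂` is `≡ 1 (mod 𝔪)`**: `ζ ∈ ℤ̄₂ˣ` and
`(ζ̄ - 1)^{2^r} = ζ̄^{2^r} - 1 = 0` in the residue field of characteristic `2`. [folklore] -/
theorem PadicAlgCl.exists_residue_eq_one_of_pow_two_pow_eq_one {x : PadicAlgCl 2} {r : ℕ}
    (hx : x ^ 2 ^ r = 1) :
    ∃ u : padicAlgClIntegers 2, (u : PadicAlgCl 2) = x ∧ residue (padicAlgClIntegers 2) u = 1 := by
  have hO : ∀ y : PadicAlgCl 2, y ∈ padicAlgClIntegers 2 ↔ ‖y‖ ≤ 1 :=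
    padicAlgCl_mem_valuationSubring_iff 2
  have hnorm : ‖x‖ = 1 := PadicAlgCl.norm_eq_one_of_pow_eq_one (pow_ne_zero r two_ne_zero) hx
  let u : padicAlgClIntegers 2 := ⟨x, (hO x).mpr hnorm.le⟩
  refine ⟨u, rfl, ?_⟩
  haveI : CharP (padicAlgClResidueField 2) 2 := charP_padicAlgClResidueField_two
  have hu : u ^ 2 ^ r = 1 := Subtype.ext (by
    change (u : PadicAlgCl 2) ^ 2 ^ r = 1
    exact hx)
  have h1 : (residue (padicAlgClIntegers 2) u - 1) ^ 2 ^ r = 0 := by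
    rw [sub_pow_char_pow, ← map_pow, hu, map_one, one_pow, sub_self]
  exact sub_eq_zero.mp (pow_eq_zero_iff (pow_ne_zero r two_ne_zero) |>.mp h1)

end Dyadic

/-! ### The global character with prescribed inertial restriction, continuous form -/

section Globalise

variable (p : ℕ) [Fact p.Prime] (v : HeightOneSpectrum (𝓞 ℚ))

/-- A homomorphism with open kernel into a topological group is continuous. [folklore] -/
private theorem continuous_of_isOpen_ker' {Γ H : Type*} [Group Γ] [TopologicalSpace Γ]
    [IsTopologicalGroup Γ] [Group H] [TopologicalSpace H] [ContinuousMul H] (σ : Γ →* H)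
    (hker : IsOpen (σ.ker : Set Γ)) : Continuous σ := by
  refine continuous_of_continuousAt_one σ ?_
  rw [ContinuousAt, map_one]
  refine Filter.tendsto_def.mpr fun W hW => Filter.mem_of_superset (hker.mem_nhds σ.ker.one_mem) ?_
  intro x hx
  rw [Set.mem_preimage, (MonoidHom.mem_ker).mp hx]
  exact mem_of_mem_nhds hW

/-- **The global finite-order character of `Γ_ℚ` with prescribed restriction to the inertia group
at `p`, as a continuous character `Γ_ℚ →ₜ* ℚ̄_pˣ`.**  For a continuous finite-order
`χ : Γ_{ℚ_v} → ℤ̄_p` (`v ∣ p`) there are `m ≥ 1` and a continuous `θ : Γ_ℚ → ℚ̄_pˣ` with open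
kernel, `θ^{p^{m-1}(p-1)} = 1`, and `θ(res i) = χ(i)` for every `i` in the inertia group
`I_{ℚ_v}` (the tree's `adicCompletion_rat_exists_monoidHom_apply_absGaloisRestrict_eq_of_mem_absInertia`:
local Kronecker–Weber in inertia form and the global cyclotomic character).
[cite: SerreLocalFields1979, Ch. XIV §7 Thm. 2] [cite: Washington1997, Thm. 14.2] -/
theorem adicCompletion_rat_exists_continuousMonoidHom_apply_absGaloisRestrict_eq
    (hv : (Rat.HeightOneSpectrum.primesEquiv v : ℕ) = p)
    (χ : absoluteGaloisGroup (v.adicCompletion ℚ) →* padicAlgClIntegers p) {N : ℕ} (hN : 0 < N)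
    (hχN : ∀ σ, (χ σ : PadicAlgCl p) ^ N = 1) (hcont : Continuous fun σ ↦ (χ σ : PadicAlgCl p)) :
    ∃ (m : ℕ) (θ : absoluteGaloisGroup ℚ →ₜ* (PadicAlgCl p)ˣ), 0 < m ∧
      (∀ σ, θ σ ^ (p ^ (m - 1) * (p - 1)) = 1) ∧
      IsOpen (((θ : absoluteGaloisGroup ℚ →* (PadicAlgCl p)ˣ)).ker : Set (absoluteGaloisGroup ℚ)) ∧
      ∀ i ∈ absInertia (v.adicCompletion ℚ),
        ((θ (absGaloisRestrict ℚ (v.adicCompletion ℚ) i) : (PadicAlgCl p)ˣ) : PadicAlgCl p) = χ i := by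
  -- the unit-valued local character `Λ`
  let Λ : absoluteGaloisGroup (v.adicCompletion ℚ) →* (PadicAlgCl p)ˣ :=
    ((SubringClass.subtype (padicAlgClIntegers p)).toMonoidHom.comp χ).toHomUnits
  have hΛ : ∀ σ, ((Λ σ : (PadicAlgCl p)ˣ) : PadicAlgCl p) = χ σ := fun σ ↦ rfl
  have hopenΛ : IsOpen ((Λ.ker : Subgroup _) : Set (absoluteGaloisGroup (v.adicCompletion ℚ))) :=
    isOpen_ker_toHomUnits_of_pow_eq_one χ hN hχN hcont
  obtain ⟨m, η, hm, hopen, -, hpow, hI⟩ :=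
    adicCompletion_rat_exists_monoidHom_apply_absGaloisRestrict_eq_of_mem_absInertia p v hv Λ
      hopenΛ (fun a b ↦ mul_comm _ _)
  let θ : absoluteGaloisGroup ℚ →ₜ* (PadicAlgCl p)ˣ :=
    { η with continuous_toFun := continuous_of_isOpen_ker' η hopen }
  have hθ : ∀ σ, θ σ = η σ := fun σ ↦ rfl
  refine ⟨m, θ, hm, fun σ ↦ by rw [hθ]; exact hpow σ, ?_, fun i hi ↦ ?_⟩
  · exact hopen
  · rw [hθ, hI i hi, hΛ]

end Globalise

end Literature.NumberTheory.GaloisRepresentations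

end
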